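import Literature.GroupTheory.CombinatorialGroupTheory.BinaryProductEdges
import HarnessLib

/-!
# Crossing parity on the partner graph and the mate lemma

Topic `Literature/GroupTheory/CombinatorialGroupTheory`.  Continuation of
`BinaryProductEdges.lean` (Zieschang–Vogt–Coldewey, *Surfaces and Planar Discontinuous Groups*,
LNM 835 (1980), §5.3, proof of Lemma 5.3.4: *"the chain leads from one side … to the other.
This is impossible"*).  For a cyclically Nielsen reduced cyclic product `U` with a pairing
`bar`, a side function `s : ℕ × ℕ → Bool` on the slots and the hypothesis (P2) that **every chain
has both ends on the same side** (`∀ κ, IsKernelSlot U κ → s κ = s (chainEnd U bar κ)`):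

* the edges of the component of a kernel slot are the `2 clen + 1` pairwise distinct edges of
  its chain (`compEdges_eq_image_wedge_chain`, `wedge_injOn_chain`), those of a slot on no chain
  the `2 per` pairwise distinct edges of its closed walk (`compEdges_eq_image_wedge_cyc`,
  `wedge_injOn_cyc`);
* **parity principle** (`even_card_crossings_compEdges`): every component of the partner graph
  carries an even number of crossing edges (a chain by (P2), a closed walk trivially);
* **the mate lemma** (`exists_crossing_mate`): every crossing edge has a different crossing edge
  on its component — hence at the same level, with letters governed by the types
  (`SameComp.level_eq`, `SameComp.slotLetter_eq`);
* corollaries used level by level in Zieschang's endgame: a lone crossing edge is impossible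
  (`false_of_crossing_alone`, `false_of_crossing_alone_level`), two crossing edges which are alone
  at their level share a component (`sameComp_of_crossing_pair`,
  `sameComp_of_crossing_pair_level`), and the number of crossing edges at each level is even
  (`even_card_crossing_level`), so that three at one level are impossible as well.

## References

* H. Zieschang, E. Vogt, H.-D. Coldewey, *Surfaces and Planar Discontinuous Groups*, LNM 835
  (1980), §5.3 (Thm. 5.3.2, Lemma 5.3.4, Cor. 5.3.5). [ZieschangVogtColdewey1980]
* H. Zieschang, *Alternierende Produkte in freien Gruppen II*, Abh. Math. Sem. Univ. Hamburg 28
  (1965) 219–233. [Zieschang1965]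
-/

namespace Literature.GroupTheory.CombinatorialGroupTheory

open List

namespace CycFactors

variable {α : Type*} [DecidableEq α]
variable {U : List (List (α × Bool))} {bar : ℕ → ℕ} {s : ℕ × ℕ → Bool} {σ τ ρ ρ' : ℕ × ℕ} {ε : Edge}
variable {σ₀ : ℕ × ℕ}

/-! ## The edges of a chain -/

section chainEdges

variable (h : CycNielsen U) (hU : U ≠ []) (hb : IsPairing U bar) (hσ₀ : IsKernelSlot U σ₀)
include h hU hb hσ₀

/-- **The edges of the component of a kernel slot are the `2 clen + 1` edges of its chain.**
[cite: ZieschangVogtColdewey1980, proof of Thm. 5.3.2] -/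
theorem compEdges_eq_image_wedge_chain :
    compEdges U bar σ₀ = (Finset.range (2 * clen U bar σ₀ + 1)).image (wedge U bar σ₀) := by
  ext ε
  rw [compEdges, comp_eq_toFinset_chain h hU hb hσ₀, mem_edgesOf, Finset.mem_image]
  simp only [List.mem_toFinset, Finset.mem_range]
  constructor
  · rintro ⟨ρ, hρ, hε⟩
    obtain ⟨i, hi, rfl | rfl⟩ := mem_chain_iff.1 hρ
    · rcases hε with rfl | ⟨hk, rfl⟩
      · exact ⟨2 * i, by omega, wedge_even _⟩
      · rcases i with _ | l
        · exact absurd hσ₀ hk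
        · refine ⟨2 * l + 1, by omega, ?_⟩
          rw [wedge_odd, citer_succ, cedge_cget h hU (isSlot_fpartner_citer h hU hb hσ₀ (by omega))
            (not_isKernelSlot_fpartner_citer (by omega))]
    · rcases hε with rfl | ⟨hk, rfl⟩
      · exact ⟨2 * i, by omega, by rw [wedge_even, fedge_fpartner hb (isSlot_citer h hU hb hσ₀ hi)]⟩
      · have hi' : i < clen U bar σ₀ := by
          rcases hi.lt_or_eq with hlt | rfl
          · exact hlt
          · exact absurd (isKernelSlot_chainEnd h hU hb hσ₀) hk
        exact ⟨2 * i + 1, by omega, wedge_odd _⟩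
  · rintro ⟨j, hj, rfl⟩
    rcases Nat.even_or_odd j with ⟨i, rfl⟩ | ⟨i, rfl⟩
    · refine ⟨citer U bar σ₀ i, mem_chain_iff.2 ⟨i, by omega, Or.inl rfl⟩, Or.inl ?_⟩
      rw [← two_mul, wedge_even]
    · exact ⟨fpartner U bar (citer U bar σ₀ i), mem_chain_iff.2 ⟨i, by omega, Or.inr rfl⟩,
        Or.inr ⟨not_isKernelSlot_fpartner_citer (by omega), wedge_odd _⟩⟩

/-- **The edges of a chain are pairwise distinct.** [cite: ZieschangVogtColdewey1980, proof of Thm. 5.3.2] -/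
theorem wedge_injOn_chain : Set.InjOn (wedge U bar σ₀) (Finset.range (2 * clen U bar σ₀ + 1)) := by
  intro j hj j' hj' he
  rw [Finset.coe_range, Set.mem_Iio] at hj hj'
  rcases Nat.even_or_odd j with ⟨i, rfl⟩ | ⟨i, rfl⟩ <;>
    rcases Nat.even_or_odd j' with ⟨i', rfl⟩ | ⟨i', rfl⟩
  · rw [← two_mul, ← two_mul, wedge_even, wedge_even,
      fedge_eq_fedge_iff hb (isSlot_citer h hU hb hσ₀ (by omega))] at he
    rcases he with e | e
    · have := citer_injective h hU hb hσ₀ (by omega) (by omega) e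
      omega
    · exact absurd e (citer_ne_fpartner_citer h hU hb hσ₀ (by omega) (by omega))
  · rw [← two_mul, wedge_even, wedge_odd] at he
    exact absurd he fedge_ne_cedge
  · rw [← two_mul, wedge_even, wedge_odd] at he
    exact absurd he.symm fedge_ne_cedge
  · rw [wedge_odd, wedge_odd, cedge_eq_cedge_iff h hU (isSlot_fpartner_citer h hU hb hσ₀ (by omega))
      (not_isKernelSlot_fpartner_citer (by omega))] at he
    rcases he with e | e
    · have := fpartner_citer_injective h hU hb hσ₀ (by omega) (by omega) e
      omega
    · rw [← citer_succ] at e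
      exact absurd e.symm (citer_ne_fpartner_citer h hU hb hσ₀ (by omega) (by omega))

/-- **A chain carries an even number of crossing edges** when its two ends are on the same side.
[cite: ZieschangVogtColdewey1980, proof of Lemma 5.3.4] -/
theorem even_card_crossings_compEdges_kernel (hends : s σ₀ = s (chainEnd U bar σ₀)) :
    Even (crossings s (compEdges U bar σ₀)).card := by
  rw [compEdges_eq_image_wedge_chain h hU hb hσ₀]
  refine even_card_crossings_image_wedge (wedge_injOn_chain h hU hb hσ₀) ?_
  rw [wside_zero, wside_odd]
  exact hends

end chainEdges

/-! ## The edges of a closed walk -/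

section cycEdges

variable (h : CycNielsen U) (hU : U ≠ []) (hb : IsPairing U bar) (hσ : IsSlot U σ)
  (hnc : ∀ κ, IsKernelSlot U κ → σ ∉ chain U bar κ)
include h hU hb hσ hnc

/-- **The edges of the component of a slot on no chain are the `2 per` edges of its closed walk.**
[cite: ZieschangVogtColdewey1980, proof of Thm. 5.3.2] -/
theorem compEdges_eq_image_wedge_cyc :
    compEdges U bar σ = (Finset.range (2 * per U bar σ)).image (wedge U bar σ) := by
  have hp := per_pos h hU hb hσ hnc
  have hpn := per_le_nslots h hU hb hσ hnc
  ext ε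
  rw [compEdges, comp_eq_toFinset_cyc h hU hb hσ hnc, mem_edgesOf, Finset.mem_image]
  simp only [List.mem_toFinset, Finset.mem_range]
  constructor
  · rintro ⟨ρ, hρ, hε⟩
    obtain ⟨i, hi, rfl | rfl⟩ := mem_cyc_iff.1 hρ
    · rcases hε with rfl | ⟨hk, rfl⟩
      · exact ⟨2 * i, by omega, wedge_even _⟩
      · rcases i with _ | l
        · refine ⟨2 * (per U bar σ - 1) + 1, by omega, ?_⟩
          rw [wedge_odd, citer_zero, ← cget_eq_fpartner_citer_pred h hU hb hσ hnc,
            cedge_cget h hU hσ (not_isKernelSlot_of_noChain hnc)]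
        · refine ⟨2 * l + 1, by omega, ?_⟩
          rw [wedge_odd, citer_succ, cedge_cget h hU
            (isSlot_fpartner_citer_of_noChain h hU hb hσ hnc (by omega))
            (not_isKernelSlot_fpartner_citer_of_noChain h hU hb hσ hnc (by omega))]
    · rcases hε with rfl | ⟨hk, rfl⟩
      · exact ⟨2 * i, by omega, by rw [wedge_even, fedge_fpartner hb
          (isSlot_citer_of_noChain h hU hb hσ hnc (by omega))]⟩
      · exact ⟨2 * i + 1, by omega, wedge_odd _⟩
  · rintro ⟨j, hj, rfl⟩
    rcases Nat.even_or_odd j with ⟨i, rfl⟩ | ⟨i, rfl⟩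
    · refine ⟨citer U bar σ i, mem_cyc_iff.2 ⟨i, by omega, Or.inl rfl⟩, Or.inl ?_⟩
      rw [← two_mul, wedge_even]
    · exact ⟨fpartner U bar (citer U bar σ i), mem_cyc_iff.2 ⟨i, by omega, Or.inr rfl⟩,
        Or.inr ⟨not_isKernelSlot_fpartner_citer_of_noChain h hU hb hσ hnc (by omega), wedge_odd _⟩⟩

/-- **The edges of a closed walk are pairwise distinct.** [cite: ZieschangVogtColdewey1980, proof of Thm. 5.3.2] -/
theorem wedge_injOn_cyc : Set.InjOn (wedge U bar σ) (Finset.range (2 * per U bar σ)) := by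
  have hpn := per_le_nslots h hU hb hσ hnc
  intro j hj j' hj' he
  rw [Finset.coe_range, Set.mem_Iio] at hj hj'
  rcases Nat.even_or_odd j with ⟨i, rfl⟩ | ⟨i, rfl⟩ <;>
    rcases Nat.even_or_odd j' with ⟨i', rfl⟩ | ⟨i', rfl⟩
  · rw [← two_mul, ← two_mul, wedge_even, wedge_even,
      fedge_eq_fedge_iff hb (isSlot_citer_of_noChain h hU hb hσ hnc (by omega))] at he
    rcases he with e | e
    · have := citer_injOn_of_noChain h hU hb hσ hnc (by omega) (by omega) e
      omega
    · exact absurd e (citer_ne_fpartner_citer_of_noChain h hU hb hσ hnc (by omega) (by omega))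
  · rw [← two_mul, wedge_even, wedge_odd] at he
    exact absurd he fedge_ne_cedge
  · rw [← two_mul, wedge_even, wedge_odd] at he
    exact absurd he.symm fedge_ne_cedge
  · rw [wedge_odd, wedge_odd, cedge_eq_cedge_iff h hU
      (isSlot_fpartner_citer_of_noChain h hU hb hσ hnc (by omega))
      (not_isKernelSlot_fpartner_citer_of_noChain h hU hb hσ hnc (by omega))] at he
    rcases he with e | e
    · have := fpartner_citer_injOn_of_noChain h hU hb hσ hnc (by omega) (by omega) e
      omega
    · rw [← citer_succ] at e
      exact absurd e.symm (citer_ne_fpartner_citer_of_noChain h hU hb hσ hnc (by omega) (by omega))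

/-- **A closed walk carries an even number of crossing edges.**
[cite: ZieschangVogtColdewey1980, proof of Lemma 5.3.4] -/
theorem even_card_crossings_compEdges_noChain : Even (crossings s (compEdges U bar σ)).card := by
  rw [compEdges_eq_image_wedge_cyc h hU hb hσ hnc]
  refine even_card_crossings_image_wedge (wedge_injOn_cyc h hU hb hσ hnc) ?_
  rw [wside_zero, wside_even, citer_per h hU hb hσ hnc]

end cycEdges


/-- The component of an edge (the component of one of its ends). [folklore] -/
noncomputable def ecomp (U : List (List (α × Bool))) (bar : ℕ → ℕ) (ε : Edge) : Finset (ℕ × ℕ) :=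
  comp U bar ε.2.out.1

/-- The component of an edge is the component of each of its ends. [folklore] -/
theorem IsEdge.ecomp_eq (h : CycNielsen U) (hU : U ≠ []) (hb : IsPairing U bar)
    (hε : IsEdge U bar ε) (hρ : ρ ∈ ε.2) : ecomp U bar ε = comp U bar ρ :=
  ((hε.sameComp h hU hb (Sym2.out_fst_mem _) hρ).comp_eq h hU hb).symm

/-- All ends of an edge with an end of level `e` have level `e`. [folklore] -/
theorem IsEdge.level_eq_of_exists (h : CycNielsen U) (hU : U ≠ []) (hb : IsPairing U bar)
    (hε : IsEdge U bar ε) {e : ℕ} (he : ∃ ρ ∈ ε.2, level U ρ = e) (hρ' : ρ' ∈ ε.2) :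
    level U ρ' = e := by
  obtain ⟨ρ, hρ, rfl⟩ := he
  exact hε.level_eq h hU hb hρ hρ'

/-! ## The parity principle and the mate lemma -/

section parity

variable (h : CycNielsen U) (hU : U ≠ []) (hb : IsPairing U bar)
  (hP2 : ∀ κ, IsKernelSlot U κ → s κ = s (chainEnd U bar κ))
include h hU hb hP2

/-- **Parity principle: every component of the partner graph carries an even number of crossing
edges**, provided every chain has both ends on the same side.
[cite: ZieschangVogtColdewey1980, proof of Lemma 5.3.4] -/
theorem even_card_crossings_compEdges (hσ : IsSlot U σ) : Even (crossings s (compEdges U bar σ)).card := by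
  by_cases hc : ∃ κ, IsKernelSlot U κ ∧ σ ∈ chain U bar κ
  · obtain ⟨κ, hκ, hmem⟩ := hc
    rw [compEdges, comp_eq_toFinset_chain_of_mem h hU hb hκ hmem, ← comp_eq_toFinset_chain h hU hb hκ,
      ← compEdges]
    exact even_card_crossings_compEdges_kernel h hU hb hκ (hP2 κ hκ)
  · push Not at hc
    exact even_card_crossings_compEdges_noChain h hU hb hσ hc

/-- **The mate lemma**: every crossing edge `ε` of the partner graph has a *mate* — a different
crossing edge `ε'` on the same component; in particular all ends of `ε` and `ε'` have one level,
and ends of equal type carry equal letters (`SameComp.level_eq`, `SameComp.slotLetter_eq`).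
[cite: ZieschangVogtColdewey1980, proof of Lemma 5.3.4] -/
theorem exists_crossing_mate (hε : IsEdge U bar ε) (hc : IsCrossing s ε) :
    ∃ ε', IsEdge U bar ε' ∧ IsCrossing s ε' ∧ ε' ≠ ε ∧
      ∀ ρ ∈ ε.2, ∀ ρ' ∈ ε'.2, SameComp U bar ρ ρ' := by
  obtain ⟨σ, hσ, hεσ⟩ := hε
  have hσε : σ ∈ ε.2 := by
    rcases hεσ with rfl | ⟨_, rfl⟩
    · exact mem_fedge.2 (Or.inl rfl)
    · exact mem_cedge.2 (Or.inl rfl)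
  have hε : IsEdge U bar ε := ⟨σ, hσ, hεσ⟩
  have hmem : ε ∈ crossings s (compEdges U bar σ) :=
    mem_crossings.2 ⟨hε.mem_compEdges h hU hb hσε, hc⟩
  have hev := even_card_crossings_compEdges h hU hb hP2 hσ
  obtain ⟨ε', hε', hne⟩ : ∃ ε' ∈ crossings s (compEdges U bar σ), ε' ≠ ε := by
    by_contra hcon
    push Not at hcon
    have e1 : crossings s (compEdges U bar σ) = {ε} :=
      Finset.eq_singleton_iff_unique_mem.2 ⟨hmem, hcon⟩
    rw [e1, Finset.card_singleton] at hev
    exact Nat.not_even_one hev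
  obtain ⟨hε'c, hc'⟩ := mem_crossings.1 hε'
  obtain ⟨hE', -⟩ := (mem_compEdges_iff h hU hb).1 hε'c
  refine ⟨ε', hE', hc', hne, fun ρ hρ ρ' hρ' => ?_⟩
  have h1 := mem_comp_of_mem_compEdges h hU hb hε'c hρ'
  rw [mem_comp] at h1
  exact ((hε.sameComp h hU hb hρ hσε).trans h1.2)

/-- **A lone crossing edge is impossible**: if every crossing edge on the component of the
crossing edge `ε` equals `ε`, contradiction. [cite: ZieschangVogtColdewey1980, proof of Lemma 5.3.4] -/
theorem false_of_crossing_alone (hε : IsEdge U bar ε) (hc : IsCrossing s ε)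
    (halone : ∀ ε', IsEdge U bar ε' → IsCrossing s ε' →
      (∀ ρ ∈ ε.2, ∀ ρ' ∈ ε'.2, SameComp U bar ρ ρ') → ε' = ε) : False := by
  obtain ⟨ε', h1, h2, h3, h4⟩ := exists_crossing_mate h hU hb hP2 hε hc
  exact h3 (halone ε' h1 h2 h4)

/-- **Two crossing edges alone on a component-closed family share a component**: if every crossing
edge other than `ε₁` on the component of `ε₁` is `ε₂`, then `ε₁` and `ε₂` lie on one component.
[cite: ZieschangVogtColdewey1980, proof of Lemma 5.3.4] -/
theorem sameComp_of_crossing_pair {ε₁ ε₂ : Edge} (hε : IsEdge U bar ε₁) (hc : IsCrossing s ε₁)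
    (honly : ∀ ε', IsEdge U bar ε' → IsCrossing s ε' → ε' ≠ ε₁ →
      (∀ ρ ∈ ε₁.2, ∀ ρ' ∈ ε'.2, SameComp U bar ρ ρ') → ε' = ε₂) :
    ∀ ρ ∈ ε₁.2, ∀ ρ' ∈ ε₂.2, SameComp U bar ρ ρ' := by
  obtain ⟨ε', h1, h2, h3, h4⟩ := exists_crossing_mate h hU hb hP2 hε hc
  rw [← honly ε' h1 h2 h3 h4]
  exact h4

/-- **A lone crossing edge at a level is impossible**: if every crossing edge all of whose ends
have level `e` is `ε`, where `ε` is a crossing edge with an end of level `e`, contradiction.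
[cite: ZieschangVogtColdewey1980, proof of Lemma 5.3.4] -/
theorem false_of_crossing_alone_level {e : ℕ} (hε : IsEdge U bar ε) (hc : IsCrossing s ε)
    (he : ∃ ρ ∈ ε.2, level U ρ = e)
    (halone : ∀ ε', IsEdge U bar ε' → IsCrossing s ε' → (∀ ρ' ∈ ε'.2, level U ρ' = e) → ε' = ε) :
    False := by
  obtain ⟨ρ₀, hρ₀, rfl⟩ := he
  refine false_of_crossing_alone h hU hb hP2 hε hc fun ε' h1 h2 h3 => halone ε' h1 h2 fun ρ' hρ' => ?_
  exact (h3 ρ₀ hρ₀ ρ' hρ').level_eq h hU hb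

/-- **Two crossing edges alone at their level share a component**: if the crossing edges all of
whose ends have level `e` are among `ε₁, ε₂`, where `ε₁` is a crossing edge with an end of level
`e`, then every end of `ε₁` is on the component of every end of `ε₂` (so ends of equal type
carry equal letters, `SameComp.slotLetter_eq_of_slotType_eq`).
[cite: ZieschangVogtColdewey1980, proof of Lemma 5.3.4] -/
theorem sameComp_of_crossing_pair_level {ε₁ ε₂ : Edge} {e : ℕ} (hε : IsEdge U bar ε₁)
    (hc : IsCrossing s ε₁) (he : ∃ ρ ∈ ε₁.2, level U ρ = e)
    (honly : ∀ ε', IsEdge U bar ε' → IsCrossing s ε' → (∀ ρ' ∈ ε'.2, level U ρ' = e) →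
      ε' = ε₁ ∨ ε' = ε₂) :
    ∀ ρ ∈ ε₁.2, ∀ ρ' ∈ ε₂.2, SameComp U bar ρ ρ' := by
  obtain ⟨ρ₀, hρ₀, rfl⟩ := he
  refine sameComp_of_crossing_pair h hU hb hP2 hε hc fun ε' h1 h2 h3 h4 => ?_
  rcases honly ε' h1 h2 (fun ρ' hρ' => (h4 ρ₀ hρ₀ ρ' hρ').level_eq h hU hb) with h5 | h5
  · exact absurd h5 h3
  · exact h5

/-- **The number of crossing edges at each level is even.**  Here `E` is the set of all crossing
edges having an end of level `e` (equivalently, all of whose ends have level `e`); it is the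
disjoint union, over the components of level `e`, of their crossing edges.  With at most three
candidate crossing edges at a level this leaves `0` or `2` of them, and two lie on one component
(`sameComp_of_crossing_pair`). [cite: ZieschangVogtColdewey1980, proof of Lemma 5.3.4] -/
theorem even_card_crossing_level (e : ℕ) (E : Finset Edge)
    (hE : ∀ ε, ε ∈ E ↔ IsEdge U bar ε ∧ IsCrossing s ε ∧ ∃ ρ ∈ ε.2, level U ρ = e) :
    Even E.card := by
  rw [Finset.card_eq_sum_card_fiberwise (f := ecomp U bar) (t := E.image (ecomp U bar))
    (fun ε hε => Finset.mem_coe.2 (Finset.mem_image_of_mem _ (Finset.mem_coe.1 hε)))]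
  refine Finset.sum_induction _ Even (fun a b ha hb => ha.add hb) Even.zero fun C hC => ?_
  obtain ⟨ε, hε, rfl⟩ := Finset.mem_image.1 hC
  obtain ⟨hεE, -, ρ, hρ, hl⟩ := (hE ε).1 hε
  have hρs : IsSlot U ρ := hεE.isSlot_of_mem h hU hb hρ
  have key : ∀ ε', ε' ∈ E.filter (fun ε' => ecomp U bar ε' = ecomp U bar ε) ↔
      ε' ∈ crossings s (compEdges U bar ρ) := by
    intro ε'
    rw [Finset.mem_filter, mem_crossings, mem_compEdges_iff h hU hb, hE, hεE.ecomp_eq h hU hb hρ]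
    constructor
    · rintro ⟨⟨hε', hc', _⟩, hcomp⟩
      refine ⟨⟨hε', _, Sym2.out_fst_mem _, ?_⟩, hc'⟩
      rw [← hcomp]
      exact mem_comp_self (hε'.isSlot_of_mem h hU hb (Sym2.out_fst_mem _))
    · rintro ⟨⟨hε', ρ', hρ', hmem⟩, hc'⟩
      refine ⟨⟨hε', hc', ρ', hρ', ?_⟩, ?_⟩
      · rw [← hl]
        exact level_eq_of_mem_comp h hU hb hmem
      · rw [hε'.ecomp_eq h hU hb hρ']
        exact comp_eq_of_mem h hU hb hmem
  rw [Finset.ext key]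
  exact even_card_crossings_compEdges h hU hb hP2 hρs

end parity

end CycFactors

end Literature.GroupTheory.CombinatorialGroupTheory
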